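import Summits.BirchSwinnertonDyer.BirchSwinnertonDyer.Theorems.KolyvaginRoadThreeWitnessAnyFrameLeaf
import Literature.NumberTheory.EllipticCurves.HeegnerPointsOfConductorOneGaloisConjProofs
import HarnessLib

/-!
# Rung K2 (class X11b, p ∥ N, any odd p): the witness-at-any-frame leaf theorems with Shimura reciprocity
# SUPPLIED (cell `bsd-stepL`, seat `bsd-stepL-mult-p3`, session g2; `--supports stmt-BirchSwinnertonDyer-19574`)

HONEST FRAMING (cell `bsd-stepL`). `KolyvaginRoadThreeWitnessAnyFrameLeaf` (session g0, p539613 ∕ p540588) proves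
the K2 leaf `BSDp W p` from ONE non-zero Kolyvagin class at any frame (§1), from the typed cruxes K-SZ14♯ ∕ SZ14♭ at
`p ≥ 5` (§2, §4) and, at `p = 3`, from the ∃-frame weakening of crux 19574 (§3) — each modulo published named facts
among which `hrec` = Shimura reciprocity at conductor `1` (Darmon 2004 Thm. 3.7 ∕ Gross 1991 §4). That binder is a
THEOREM of the tree (`heegnerPointOfConductor_one_galoisConj_holds`, `HeegnerPointsOfConductorOneGaloisConjProofs`,
2026-08-27); this file re-issues the four theorems with it SUPPLIED — every other binder and each conclusion
VERBATIM. Remaining named facts: Gross–Zagier, Kolyvagin ×2, Skinner 2016 Thm. C, GZK, modularity ×2, (Hoffstein–Luo),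
Mazur's Manin constant, McCallum 1991 Cor. 5.6; plus the witness ∕ typed crux. CONDITIONAL; item 19574 NOT closed;
nothing booked; 0 classes move (T7).

References: [McCallumLMS1991] §5 Cor. 5.6; [WZhang2014] Thm. 1.1, Remark 5; [SkinnerZhang2014] Thm. 1.3 (shape);
[Darmon2004] Thm. 3.7; [Mazur1978] Cor. 4.1; [Miller2011LMS] Def. 1.1.
-/

set_option autoImplicit false

noncomputable section

open scoped Classical

namespace Summit.BirchSwinnertonDyer.Rank1Residual.X11b.Three.Koly

open WeierstrassCurve NumberField Literature.NumberTheory.EllipticCurves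
  Literature.NumberTheory.EllipticCurves.ModularForms
  Literature.NumberTheory.EllipticCurves.Rank1Residual
  Summit.BirchSwinnertonDyer.Rank1Residual Summit.BirchSwinnertonDyer.Rank1Residual.X11b
  Summit.BirchSwinnertonDyer.BirchSwinnertonDyer.Theses.KolyvaginRoadThree

/-- **§1′ `BSD(E,p)` from ONE non-zero Kolyvagin class at ANY frame of a Hoffstein–Luo field, `hrec` SUPPLIED.**
`bsdp_of_kolyvaginWitness_of_mccallum` with Shimura reciprocity at conductor `1` discharged by
`heegnerPointOfConductor_one_galoisConj_holds`. CONDITIONAL on the remaining binders; nothing booked.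
[cite: McCallumLMS1991, §5 Cor. 5.6 (p. 310)] [cite: Darmon2004, Thm. 3.7] [cite: Miller2011LMS, Def. 1.1] -/
theorem bsdp_of_kolyvaginWitness_of_mccallum'
    (hGZ : ∀ (N : ℕ) [NeZero N] (W : WeierstrassCurve ℚ) (K : Type) [Field K] [NumberField K],
      gross_zagier N W K)
    (hKo : ∀ (N : ℕ) [NeZero N] (W : WeierstrassCurve ℚ) (K : Type) [Field K] [NumberField K],
      kolyvagin N W K)
    (hB : ∀ (N : ℕ) [NeZero N] (W : WeierstrassCurve ℚ) (K : Type) [Field K] [NumberField K],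
      Kolyvagin1990_padicValNat_card_sha_le N W K)
    (hSk : Skinner2016.thmC_padicValRat_bsd_rank_zero)
    (hGZK : rank_eq_analyticRank_of_analyticRank_le_one) (hmod : hasEntireLFunction_rat)
    (hnf : exists_isNewformOf) (hMaz : mazur_not_dvd_maninConstant_of_odd)
    (hMc : McCallum1991_pow_dvd_card_sha_primary_of_certificate)
    (W : WeierstrassCurve ℚ) [W.IsElliptic] [W.IsGloballyMinimal] [NeZero (W.conductorNorm ℤ)]
    (p : ℕ) [hp' : Fact p.Prime]
    (hX : ClassX11b W p) (hram : Ram W p) (htam : ¬ p ∣ W.tamagawaProduct)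
    (K : Type) [Field K] [NumberField K] (hK : IsImaginaryQuadratic K) (hodd : Odd (NumberField.discr K))
    (hlt : NumberField.discr K < -4) (hHN : SatisfiesHeegnerHypothesis (W.conductorNorm ℤ) K)
    (hLt : (W.quadraticTwist (NumberField.discr K : ℚ)).entireLFunction 1 ≠ 0)
    {Dt' : ModularParametrizationData W (W.conductorNorm ℤ)} {β' : ℤ} {ι' : K →+* ℂ} {n : ℕ}
    (d : KolyvaginHeegnerData Dt' β' ι' n)
    (hn : KolyvaginDescent.KolSupp (Zhang2014.IsKolyvaginPrime (W.conductorNorm ℤ) W K p) n)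
    (hne : d.kolyvaginClass hp'.out 1 ≠ 0) : BSDp W p :=
  bsdp_of_kolyvaginWitness_of_mccallum hGZ hKo hB hSk hGZK hmod hnf hMaz
    (fun N _ W K _ _ ↦ heegnerPointOfConductor_one_galoisConj_holds N W K) hMc W p hX hram htam K hK hodd hlt
    hHN hLt d hn hne

/-- **§2′ K-SZ14♯ (∃-framed typed crux) ⟹ the K2 leaf on the Locus at `p ≥ 5`, `hrec` SUPPLIED.**
[cite: SkinnerZhang2014, Thm. 1.3 (shape)] [cite: McCallumLMS1991, §5 Cor. 5.6] [cite: Darmon2004, Thm. 3.7] -/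
theorem bsdp_of_skinnerZhangSharp_of_mccallum'
    (hGZ : ∀ (N : ℕ) [NeZero N] (W : WeierstrassCurve ℚ) (K : Type) [Field K] [NumberField K],
      gross_zagier N W K)
    (hKo : ∀ (N : ℕ) [NeZero N] (W : WeierstrassCurve ℚ) (K : Type) [Field K] [NumberField K],
      kolyvagin N W K)
    (hB : ∀ (N : ℕ) [NeZero N] (W : WeierstrassCurve ℚ) (K : Type) [Field K] [NumberField K],
      Kolyvagin1990_padicValNat_card_sha_le N W K)
    (hSk : Skinner2016.thmC_padicValRat_bsd_rank_zero)
    (hGZK : rank_eq_analyticRank_of_analyticRank_le_one) (hmod : hasEntireLFunction_rat)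
    (hnf : exists_isNewformOf) (hHL : HoffsteinLuo1997_exists_twist_L_one_ne_zero)
    (hMaz : mazur_not_dvd_maninConstant_of_odd)
    (hMc : McCallum1991_pow_dvd_card_sha_primary_of_certificate)
    (W : WeierstrassCurve ℚ) [W.IsElliptic] [W.IsGloballyMinimal] [NeZero (W.conductorNorm ℤ)]
    (p : ℕ) [Fact p.Prime]
    (hSZs : ∀ (K : Type) [Field K] [NumberField K], SkinnerZhangSharp W p K)
    (hX : ClassX11b W p) (hp5 : 5 ≤ p) (hram : Ram W p) (htam : ¬ p ∣ W.tamagawaProduct) :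
    BSDp W p :=
  bsdp_of_skinnerZhangSharp_of_mccallum hGZ hKo hB hSk hGZK hmod hnf hHL hMaz
    (fun N _ W K _ _ ↦ heegnerPointOfConductor_one_galoisConj_holds N W K) hMc W p hSZs hX hp5 hram htam

/-- **§3′ `p = 3`: the ∃-frame weakening of crux 19574 ⟹ `BSD(E,3)` on A1, `hrec` SUPPLIED.**
[cite: WZhang2014, Thm. 1.1, Remark 5] [cite: McCallumLMS1991, §5 Cor. 5.6] [cite: Darmon2004, Thm. 3.7] -/
theorem bsdp_three_onA1_of_existsKolyvaginWitnessHL'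
    (hGZ : ∀ (N : ℕ) [NeZero N] (W : WeierstrassCurve ℚ) (K : Type) [Field K] [NumberField K],
      gross_zagier N W K)
    (hKo : ∀ (N : ℕ) [NeZero N] (W : WeierstrassCurve ℚ) (K : Type) [Field K] [NumberField K],
      kolyvagin N W K)
    (hB : ∀ (N : ℕ) [NeZero N] (W : WeierstrassCurve ℚ) (K : Type) [Field K] [NumberField K],
      Kolyvagin1990_padicValNat_card_sha_le N W K)
    (hSk : Skinner2016.thmC_padicValRat_bsd_rank_zero)
    (hGZK : rank_eq_analyticRank_of_analyticRank_le_one) (hmod : hasEntireLFunction_rat)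
    (hnf : exists_isNewformOf) (hHL : HoffsteinLuo1997_exists_twist_L_one_ne_zero)
    (hMaz : mazur_not_dvd_maninConstant_of_odd)
    (hMc : McCallum1991_pow_dvd_card_sha_primary_of_certificate)
    (hZ : ∀ (W : WeierstrassCurve ℚ) [W.IsElliptic] [W.IsGloballyMinimal] [NeZero (W.conductorNorm ℤ)]
      (K : Type) [Field K] [NumberField K],
      ClassX11b W 3 → Rank1Residual.Surj W 3 → Rank1Residual.Ram W 3 → ¬ 3 ∣ W.tamagawaProduct →
      IsImaginaryQuadratic K → Odd (NumberField.discr K) → NumberField.discr K < -4 →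
      SatisfiesHeegnerHypothesis (W.conductorNorm ℤ) K →
      (W.quadraticTwist (NumberField.discr K : ℚ)).entireLFunction 1 ≠ 0 →
      ∃ (Dt : ModularParametrizationData W (W.conductorNorm ℤ)) (β : ℤ) (ι : K →+* ℂ) (n : ℕ)
        (d : KolyvaginHeegnerData Dt β ι n),
        KolyvaginDescent.KolSupp (Zhang2014.IsKolyvaginPrime (W.conductorNorm ℤ) W K 3) n ∧
          d.kolyvaginClass Nat.prime_three 1 ≠ 0) :
    ∀ (W : WeierstrassCurve ℚ) [W.IsElliptic] [W.IsGloballyMinimal],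
      ClassX11b W 3 → Ram W 3 → ¬ 3 ∣ W.tamagawaProduct → BSDp W 3 :=
  bsdp_three_onA1_of_existsKolyvaginWitnessHL hGZ hKo hB hSk hGZK hmod hnf hHL hMaz
    (fun N _ W K _ _ ↦ heegnerPointOfConductor_one_galoisConj_holds N W K) hMc hZ

/-- **§4′ SZ14♭ (typed, ∃-framed) ⟹ the K2 leaf on its locus at `p ≥ 5`, `hrec` SUPPLIED.**
[cite: SkinnerZhang2014, Thm. 1.3 (shape, 𝓛-clause deleted)] [cite: McCallumLMS1991, §5 Cor. 5.6] [cite: Darmon2004, Thm. 3.7] -/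
theorem bsdp_of_skinnerZhangFlat_of_mccallum'
    (hGZ : ∀ (N : ℕ) [NeZero N] (W : WeierstrassCurve ℚ) (K : Type) [Field K] [NumberField K],
      gross_zagier N W K)
    (hKo : ∀ (N : ℕ) [NeZero N] (W : WeierstrassCurve ℚ) (K : Type) [Field K] [NumberField K],
      kolyvagin N W K)
    (hB : ∀ (N : ℕ) [NeZero N] (W : WeierstrassCurve ℚ) (K : Type) [Field K] [NumberField K],
      Kolyvagin1990_padicValNat_card_sha_le N W K)
    (hSk : Skinner2016.thmC_padicValRat_bsd_rank_zero)
    (hGZK : rank_eq_analyticRank_of_analyticRank_le_one) (hmod : hasEntireLFunction_rat)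
    (hnf : exists_isNewformOf) (hHL : HoffsteinLuo1997_exists_twist_L_one_ne_zero)
    (hMaz : mazur_not_dvd_maninConstant_of_odd)
    (hMc : McCallum1991_pow_dvd_card_sha_primary_of_certificate)
    (W : WeierstrassCurve ℚ) [W.IsElliptic] [W.IsGloballyMinimal] [NeZero (W.conductorNorm ℤ)]
    (p : ℕ) [Fact p.Prime]
    (hSZf : ∀ (K : Type) [Field K] [NumberField K], SkinnerZhangFlat W p K)
    (hX : ClassX11b W p) (hp5 : 5 ≤ p)
    (hfin : ¬ p ∣ padicValInt p W.minimalDiscriminantInt)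
    (hramAll : ∀ (ℓ : ℕ) [Fact ℓ.Prime], ℓ ≠ p → W.HasMultiplicativeReductionAtPrime ℓ →
      ¬ p ∣ padicValInt ℓ W.minimalDiscriminantInt)
    (hram : Ram W p) : BSDp W p :=
  bsdp_of_skinnerZhangFlat_of_mccallum hGZ hKo hB hSk hGZK hmod hnf hHL hMaz
    (fun N _ W K _ _ ↦ heegnerPointOfConductor_one_galoisConj_holds N W K) hMc W p hSZf hX hp5 hfin hramAll
    hram

end Summit.BirchSwinnertonDyer.Rank1Residual.X11b.Three.Koly

end
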